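import Mathlib
import Literature.NumberTheory.Transcendental.AssociatorsCocycleProofs
import HarnessLib

/-!
# Associators XIV: vanishing of degree-`m ≥ 3` two-cocycles of the free algebra functor

Proofs file towards [Furusho2010, Thm 1] (`furusho_pentagon_hexagon`), fourth step of the
inductive cocycle argument: the purely combinatorial statement. Let `Ψ ∈ k⟨⟨X,Y⟩⟩` and `N ≥ 3`,
and suppose the **cocycle identity**
`Ψ(x₀ + x₁, x₂) + Ψ(x₀, x₁) = Ψ(x₀, x₁ + x₂) + Ψ(x₁, x₂)` holds in the free truncated algebra
`k⟨x₀,x₁,x₂⟩/(deg > N)` (`x_c` the letter classes). Comparing coefficients of a word `u` in the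
three letters (`NCSeries.coeff_relations_of_cocycle`):
* if `u` contains `0` and `2`: `c_{π₀₁ u}(Ψ) = c_{π₁₂ u}(Ψ)`, where `π₀₁` merges the letters `0, 1`
  into `X` (`2 ↦ Y`) and `π₁₂` merges `1, 2` into `Y` (`0 ↦ X`);
* if `u` contains `0` but not `2`: `c_{Xⁿ}(Ψ) = 0`; if `u` contains `2` but not `0`: `c_{Yⁿ}(Ψ) = 0`.
For words of length `N ≥ 3` these relations connect all MIXED words (flip the first `X` of a
word with `≥ 2` `X`'s; link the single-`X` words through the two-`X` words), so
`c_w(Ψ) = c · [w mixed]` in degree `N` (`NCSeries.apply_eq_apply_e₀_of_cocycle`): in the language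
of functor cohomology, the normalised complex `n ↦ k⟨x₁,…,x_n⟩_N` (insert / double a variable)
has no `2`-cocycles of degree `N ≥ 3` other than the coboundary of `x^N`. If moreover the
degree-`N` part of `Ψ` is primitive, pairing with `X ш Y^{N-1}` gives `N c = 0`, so `Ψ` has no
terms of degree `N` at all (`NCSeries.apply_eq_zero_of_cocycle_of_isPrimitive`).

No named facts are introduced.

## References

* H. Furusho, *Pentagon and hexagon equations*, Ann. of Math. 171 (2010), 545–556. [Furusho2010]
* C. Reutenauer, *Free Lie algebras*, Oxford (1993), §1 (words, shuffles). [Reutenauer1993]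
-/

noncomputable section

open scoped BigOperators

namespace Literature.NumberTheory.Transcendental

universe u

namespace NCSeries

/-! ## 1. Letter maps `Fin 3 → Bool` and monomial substitutions -/

section LetterMaps

variable {k : Type u} [CommRing k]

/-- `π₀₁`: letters `0, 1 ↦ X = false`, `2 ↦ Y = true`. [folklore] -/
def π₀₁ : Fin 3 → Bool := fun a => decide (a = 2)

/-- `π₁₂`: letter `0 ↦ X = false`, `1, 2 ↦ Y = true`. [folklore] -/
def π₁₂ : Fin 3 → Bool := fun a => decide (a ≠ 0)

/-- Values of `π₀₁`. [folklore] -/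
@[simp] theorem π₀₁_0 : π₀₁ 0 = false := by decide
/-- Values of `π₀₁`. [folklore] -/
@[simp] theorem π₀₁_1 : π₀₁ 1 = false := by decide
/-- Values of `π₀₁`. [folklore] -/
@[simp] theorem π₀₁_2 : π₀₁ 2 = true := by decide
/-- Values of `π₁₂`. [folklore] -/
@[simp] theorem π₁₂_0 : π₁₂ 0 = false := by decide
/-- Values of `π₁₂`. [folklore] -/
@[simp] theorem π₁₂_1 : π₁₂ 1 = true := by decide
/-- Values of `π₁₂`. [folklore] -/
@[simp] theorem π₁₂_2 : π₁₂ 2 = true := by decide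

variable (k) in
/-- The total monomial substitution attached to a letter map `f`: `x_a ← X_{f a}` with
coefficient `1`. [folklore] -/
def preT (f : Fin 3 → Bool) : Fin 3 → Option (Bool × k) := fun a => some (f a, 1)

variable (k) in
/-- The partial monomial substitution: as `preT f` but the letter `a₀` has no preimage.
[folklore] -/
def preP (a₀ : Fin 3) (f : Fin 3 → Bool) : Fin 3 → Option (Bool × k) :=
  fun a => if a = a₀ then none else some (f a, 1)

/-- Preimage words under a total substitution. [folklore] -/
theorem preWord_preT (f : Fin 3 → Bool) : ∀ x : List (Fin 3),
    preWord (preT k f) x = some (x.map f, 1)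
  | [] => rfl
  | a :: x => by simp [preWord, preT, preWord_preT f x]

/-- Preimage words under a partial substitution, letter absent. [folklore] -/
theorem preWord_preP_of_not_mem (a₀ : Fin 3) (f : Fin 3 → Bool) : ∀ x : List (Fin 3), a₀ ∉ x →
    preWord (preP k a₀ f) x = some (x.map f, 1)
  | [], _ => rfl
  | a :: x, h => by
    have ha : a ≠ a₀ := by rintro rfl; exact h List.mem_cons_self
    have hx : a₀ ∉ x := fun hm => h (List.mem_cons_of_mem _ hm)
    simp [preWord, preP, ha, preWord_preP_of_not_mem a₀ f x hx]

/-- Preimage words under a partial substitution, letter present. [folklore] -/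
theorem preWord_preP_of_mem (a₀ : Fin 3) (f : Fin 3 → Bool) : ∀ x : List (Fin 3), a₀ ∈ x →
    preWord (preP k a₀ f) x = none
  | [], h => absurd h List.not_mem_nil
  | a :: x, h => by
    by_cases ha : a = a₀
    · subst ha; simp [preWord, preP]
    · have hx : a₀ ∈ x := by
        rcases List.mem_cons.mp h with e | e
        · exact absurd e.symm ha
        · exact e
      simp [preWord, preP, ha, preWord_preP_of_mem a₀ f x hx]

/-- Coefficients of the total pushforward: `c_u = c_{f u}(Ψ)`. [folklore] -/
theorem push_preT_apply (f : Fin 3 → Bool) (Ψ : NCSeries Bool k) (u : List (Fin 3)) :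
    push (monoSubst (preT k f)) Ψ u = Ψ (u.map f) := by
  simp [push_monoSubst, preWord_preT]

/-- Coefficients of the partial pushforward: `0` on words containing `a₀`, else `c_{f u}(Ψ)`.
[folklore] -/
theorem push_preP_apply (a₀ : Fin 3) (f : Fin 3 → Bool) (Ψ : NCSeries Bool k) (u : List (Fin 3)) :
    push (monoSubst (preP k a₀ f)) Ψ u = if a₀ ∈ u then 0 else Ψ (u.map f) := by
  split_ifs with h
  · simp [push_monoSubst, preWord_preP_of_mem a₀ f u h]
  · simp [push_monoSubst, preWord_preP_of_not_mem a₀ f u h]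

end LetterMaps

/-! ## 2. The four substitutions into the free truncated algebra on three letters -/

section ThreeLetters

variable {k : Type u} [CommRing k] {N : ℕ}

/-- Substituting the letters themselves gives the class of the series. [folklore] -/
theorem evalTrunc_xg (S : NCSeries (Fin 3) k) :
    evalTrunc N (xg N) S = Ideal.Quotient.mk (truncIdeal (Fin 3) k N) S := by
  rw [evalTrunc_eq_sum_wordsLE, mk_eq_sum_monomial]
  refine Finset.sum_congr rfl fun w _ => ?_
  congr 1
  rw [show (w.map (xg N)) = (w.map fun a => (letter (id a) : NCSeries (Fin 3) k)).map
      (Ideal.Quotient.mk (truncIdeal (Fin 3) k N)) from by rw [List.map_map]; rfl,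
    ← map_list_prod, prod_map_letter, List.map_id]

/-- A linear two-letter substitution into the letter classes is the class of a pushforward.
[folklore] -/
theorem evalTrunc_bsub_eq_mk_push (m : Bool → Fin 3 → k) (Ψ : NCSeries Bool k)
    {A B : NCSeries (Fin 3) k ⧸ truncIdeal (Fin 3) k N}
    (hA : A = ∑ f : Fin 3, m false f • xg N f) (hB : B = ∑ f : Fin 3, m true f • xg N f) :
    evalTrunc N (bsub A B) Ψ = Ideal.Quotient.mk (truncIdeal (Fin 3) k N) (push m Ψ) := by
  rw [← evalTrunc_xg, evalTrunc_push]
  congr 1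
  funext b
  cases b
  · exact hA
  · exact hB

/-- `Ψ(x₀ + x₁, x₂) = [push (x_a ← X_{π₀₁ a}) Ψ]`. [folklore] -/
theorem eval_01_2 (Ψ : NCSeries Bool k) :
    evalTrunc N (bsub (xg N 0 + xg N 1) (xg N 2)) Ψ =
      Ideal.Quotient.mk (truncIdeal (Fin 3) k N) (push (monoSubst (preT k π₀₁)) Ψ) :=
  evalTrunc_bsub_eq_mk_push _ Ψ (by simp [monoSubst, preT, Fin.sum_univ_three])
    (by simp [monoSubst, preT, Fin.sum_univ_three])

/-- `Ψ(x₀, x₁) = [push (x₀ ← X, x₁ ← Y, x₂ ← ∅) Ψ]`. [folklore] -/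
theorem eval_0_1 (Ψ : NCSeries Bool k) :
    evalTrunc N (bsub (xg N 0) (xg N 1)) Ψ =
      Ideal.Quotient.mk (truncIdeal (Fin 3) k N) (push (monoSubst (preP k 2 π₁₂)) Ψ) :=
  evalTrunc_bsub_eq_mk_push _ Ψ (by simp [monoSubst, preP, Fin.sum_univ_three])
    (by simp [monoSubst, preP, Fin.sum_univ_three])

/-- `Ψ(x₀, x₁ + x₂) = [push (x_a ← X_{π₁₂ a}) Ψ]`. [folklore] -/
theorem eval_0_12 (Ψ : NCSeries Bool k) :
    evalTrunc N (bsub (xg N 0) (xg N 1 + xg N 2)) Ψ =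
      Ideal.Quotient.mk (truncIdeal (Fin 3) k N) (push (monoSubst (preT k π₁₂)) Ψ) :=
  evalTrunc_bsub_eq_mk_push _ Ψ (by simp [monoSubst, preT, Fin.sum_univ_three])
    (by simp [monoSubst, preT, Fin.sum_univ_three])

/-- `Ψ(x₁, x₂) = [push (x₀ ← ∅, x₁ ← X, x₂ ← Y) Ψ]`. [folklore] -/
theorem eval_1_2 (Ψ : NCSeries Bool k) :
    evalTrunc N (bsub (xg N 1) (xg N 2)) Ψ =
      Ideal.Quotient.mk (truncIdeal (Fin 3) k N) (push (monoSubst (preP k 0 π₀₁)) Ψ) :=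
  evalTrunc_bsub_eq_mk_push _ Ψ (by simp [monoSubst, preP, Fin.sum_univ_three])
    (by simp [monoSubst, preP, Fin.sum_univ_three])

/-- **The coefficient relations of a two-cocycle.** If
`Ψ(x₀+x₁, x₂) + Ψ(x₀, x₁) = Ψ(x₀, x₁+x₂) + Ψ(x₁, x₂)` in `k⟨x₀,x₁,x₂⟩/(deg > N)` then for every word
`u` of length `≤ N` in the three letters:
(a) `c_{π₀₁ u} = c_{π₁₂ u}` if `u` contains `0` and `2`; (b) `c_{π₀₁ u} = 0` if `u` contains `0`
but not `2`; (c) `c_{π₁₂ u} = 0` if `u` contains `2` but not `0`. [folklore] -/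
theorem coeff_relations_of_cocycle {Ψ : NCSeries Bool k}
    (hC : evalTrunc N (bsub (xg (k := k) N 0 + xg N 1) (xg N 2)) Ψ +
        evalTrunc N (bsub (xg (k := k) N 0) (xg N 1)) Ψ =
      evalTrunc N (bsub (xg (k := k) N 0) (xg N 1 + xg N 2)) Ψ +
        evalTrunc N (bsub (xg (k := k) N 1) (xg N 2)) Ψ)
    {u : List (Fin 3)} (hu : u.length ≤ N) :
    (0 ∈ u → 2 ∈ u → Ψ (u.map π₀₁) = Ψ (u.map π₁₂)) ∧
      (0 ∈ u → 2 ∉ u → Ψ (u.map π₀₁) = 0) ∧ (0 ∉ u → 2 ∈ u → Ψ (u.map π₁₂) = 0) := by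
  rw [eval_01_2, eval_0_1, eval_0_12, eval_1_2, ← map_add, ← map_add, mk_eq_mk_iff] at hC
  have h := hC u hu
  rw [add_apply, add_apply, push_preT_apply, push_preT_apply, push_preP_apply, push_preP_apply] at h
  refine ⟨fun h0 h2 => ?_, fun h0 h2 => ?_, fun h0 h2 => ?_⟩
  · rw [if_pos h2, if_pos h0, add_zero, add_zero] at h
    exact h
  · rw [if_neg h2, if_pos h0, add_zero] at h
    exact add_right_cancel (b := Ψ (u.map π₁₂)) (by rwa [zero_add])
  · rw [if_pos h2, if_neg h0, add_zero] at h
    exact add_right_cancel (b := Ψ (u.map π₀₁)) (by rw [zero_add]; exact h.symm)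

end ThreeLetters

/-! ## 3. Word combinatorics: all mixed words of length `N ≥ 3` are connected -/

section Words

/-- Labels for the "flip the first `X`" move: the first `X` gets `1`, later `X`'s get `0`,
`Y`'s get `2`. [folklore] -/
def lab1 : List Bool → List (Fin 3)
  | [] => []
  | true :: w => 2 :: lab1 w
  | false :: w => 1 :: w.map fun b => if b then 2 else 0

/-- Flipping the first `X` of a word into `Y`. [folklore] -/
def flipFirst : List Bool → List Bool
  | [] => []
  | true :: w => true :: flipFirst w
  | false :: w => true :: w

/-- `π₀₁ ∘ lab1 = id`. [folklore] -/
theorem map_π₀₁_lab1 : ∀ w : List Bool, (lab1 w).map π₀₁ = w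
  | [] => rfl
  | true :: w => by rw [lab1, List.map_cons, π₀₁_2, map_π₀₁_lab1 w]
  | false :: w => by
    rw [lab1, List.map_cons, π₀₁_1, List.map_map]
    congr 1
    conv_rhs => rw [← List.map_id w]
    refine List.map_congr_left fun b _ => ?_
    cases b <;> rfl

/-- `π₁₂ ∘ lab1 = flipFirst`. [folklore] -/
theorem map_π₁₂_lab1 : ∀ w : List Bool, (lab1 w).map π₁₂ = flipFirst w
  | [] => rfl
  | true :: w => by rw [lab1, List.map_cons, π₁₂_2, map_π₁₂_lab1 w, flipFirst]
  | false :: w => by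
    rw [lab1, List.map_cons, π₁₂_1, List.map_map, flipFirst]
    congr 1
    conv_rhs => rw [← List.map_id w]
    refine List.map_congr_left fun b _ => ?_
    cases b <;> rfl

/-- `lab1` preserves the length. [folklore] -/
theorem length_lab1 : ∀ w : List Bool, (lab1 w).length = w.length
  | [] => rfl
  | true :: w => by rw [lab1, List.length_cons, length_lab1 w, List.length_cons]
  | false :: w => by rw [lab1, List.length_cons, List.length_map, List.length_cons]

/-- `0 ∈ lab1 w` as soon as `w` has two `X`'s. [folklore] -/
theorem zero_mem_lab1 : ∀ w : List Bool, 2 ≤ w.count false → (0 : Fin 3) ∈ lab1 w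
  | [], h => by simp at h
  | true :: w, h => by
    rw [List.count_cons_of_ne (by decide)] at h
    rw [lab1]
    exact List.mem_cons_of_mem _ (zero_mem_lab1 w h)
  | false :: w, h => by
    rw [List.count_cons_self] at h
    rw [lab1]
    refine List.mem_cons_of_mem _ (List.mem_map.mpr ⟨false, ?_, rfl⟩)
    exact List.count_pos_iff.mp (by omega)

/-- `2 ∈ lab1 w` as soon as `w` has a `Y`. [folklore] -/
theorem two_mem_lab1 : ∀ w : List Bool, 1 ≤ w.count true → (2 : Fin 3) ∈ lab1 w
  | [], h => by simp at h
  | true :: w, _ => by rw [lab1]; exact List.mem_cons_self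
  | false :: w, h => by
    rw [List.count_cons_of_ne (by decide)] at h
    rw [lab1]
    refine List.mem_cons_of_mem _ (List.mem_map.mpr ⟨true, ?_, rfl⟩)
    exact List.count_pos_iff.mp (by omega)

/-- `flipFirst` preserves the length. [folklore] -/
theorem length_flipFirst : ∀ w : List Bool, (flipFirst w).length = w.length
  | [] => rfl
  | true :: w => by rw [flipFirst, List.length_cons, length_flipFirst w, List.length_cons]
  | false :: w => rfl

/-- `flipFirst` removes one `X` and adds one `Y`. [folklore] -/
theorem count_flipFirst : ∀ (w : List Bool) (n : ℕ), w.count false = n + 1 →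
    (flipFirst w).count false = n ∧ (flipFirst w).count true = w.count true + 1
  | [], n, h => by simp at h
  | true :: w, n, h => by
    rw [List.count_cons_of_ne (by decide)] at h
    obtain ⟨h1, h2⟩ := count_flipFirst w n h
    refine ⟨?_, ?_⟩
    · rw [flipFirst, List.count_cons_of_ne (by decide), h1]
    · rw [flipFirst, List.count_cons_self, List.count_cons_self, h2]
  | false :: w, n, h => by
    rw [List.count_cons_self] at h
    refine ⟨?_, ?_⟩
    · rw [flipFirst, List.count_cons_of_ne (by decide)]; omega
    · rw [flipFirst, List.count_cons_self, List.count_cons_of_ne (by decide)]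

end Words

/-! ## 4. Coefficients in degree `N ≥ 3`: all mixed words have the same coefficient -/

section Mixed

variable {k : Type u} [CommRing k] {N : ℕ} {Ψ : NCSeries Bool k}

/-- The reference mixed word `X Y^{N-1}`. [folklore] -/
def e₀ (N : ℕ) : List Bool := false :: List.replicate (N - 1) true

omit [CommRing k] in
/-- **Flip move**: `c_w = c_{flipFirst w}` for a word of length `≤ N` with `≥ 2` `X`'s and
`≥ 1` `Y`. [folklore] -/
theorem apply_eq_apply_flipFirst
    (hrel : ∀ u : List (Fin 3), u.length ≤ N → (0 : Fin 3) ∈ u → (2 : Fin 3) ∈ u →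
      Ψ (u.map π₀₁) = Ψ (u.map π₁₂))
    {w : List Bool} (hw : w.length ≤ N) (hX : 2 ≤ w.count false) (hY : 1 ≤ w.count true) :
    Ψ w = Ψ (flipFirst w) := by
  have h := hrel (lab1 w) (by rw [length_lab1]; exact hw) (zero_mem_lab1 w hX) (two_mem_lab1 w hY)
  rwa [map_π₀₁_lab1, map_π₁₂_lab1] at h

omit [CommRing k] in
/-- **Single-`X` words**: `c_v = c_{X Y^{N-1}}` for every word `v` of length `N ≥ 3` with exactly
one `X`. [folklore] -/
theorem apply_eq_apply_e₀_of_count_eq_one (hN : 3 ≤ N)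
    (hrel : ∀ u : List (Fin 3), u.length ≤ N → (0 : Fin 3) ∈ u → (2 : Fin 3) ∈ u →
      Ψ (u.map π₀₁) = Ψ (u.map π₁₂))
    {v : List Bool} (hv : v.length = N) (hX : v.count false = 1) : Ψ v = Ψ (e₀ N) := by
  cases v with
  | nil => exfalso; simp at hv; omega
  | cons b v' =>
  cases b with
  | false =>
    rw [List.count_cons_self] at hX
    have h0 : v'.count false = 0 := by omega
    have hlen : v'.length = N - 1 := by simp at hv; omega
    have ht : v'.count true = N - 1 := by
      have := List.count_not_add_count v' true
      simp only [Bool.not_true] at this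
      omega
    have hv' : v' = List.replicate (N - 1) true := (eq_replicate_true_iff v' (N - 1)).mpr ⟨h0, ht⟩
    rw [hv']
    rfl
  | true =>
    rw [List.count_cons_of_ne (by decide)] at hX
    have hlen : v'.length = N - 1 := by simp at hv; omega
    have ht : v'.count true = N - 2 := by
      have := List.count_not_add_count v' true
      simp only [Bool.not_true] at this
      omega
    have hfalse : false ∈ v' := List.count_pos_iff.mp (by omega)
    have htrue : true ∈ v' := List.count_pos_iff.mp (by omega)
    -- `u = 1 :: (X ↦ 0, Y ↦ 2)`: `π₀₁ u = X v'`, `π₁₂ u = Y v' = v`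
    have h1 := hrel ((1 : Fin 3) :: v'.map fun b => if b then 2 else 0)
      (by simp; omega)
      (List.mem_cons_of_mem _ (List.mem_map.mpr ⟨false, hfalse, rfl⟩))
      (List.mem_cons_of_mem _ (List.mem_map.mpr ⟨true, htrue, rfl⟩))
    have e1 : ((1 : Fin 3) :: v'.map fun b => if b then (2 : Fin 3) else 0).map π₀₁ = false :: v' := by
      rw [List.map_cons, π₀₁_1, List.map_map]
      congr 1
      conv_rhs => rw [← List.map_id v']
      exact List.map_congr_left fun b _ => by cases b <;> rfl
    have e2 : ((1 : Fin 3) :: v'.map fun b => if b then (2 : Fin 3) else 0).map π₁₂ = true :: v' := by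
      rw [List.map_cons, π₁₂_1, List.map_map]
      congr 1
      conv_rhs => rw [← List.map_id v']
      exact List.map_congr_left fun b _ => by cases b <;> rfl
    rw [e1, e2] at h1
    -- `u' = 0 :: (X ↦ 1, Y ↦ 2)`: `π₀₁ u' = X v'`, `π₁₂ u' = X Y^{N-1}`
    have h2 := hrel ((0 : Fin 3) :: v'.map fun b => if b then 2 else 1)
      (by simp; omega) List.mem_cons_self
      (List.mem_cons_of_mem _ (List.mem_map.mpr ⟨true, htrue, rfl⟩))
    have e3 : ((0 : Fin 3) :: v'.map fun b => if b then (2 : Fin 3) else 1).map π₀₁ = false :: v' := by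
      rw [List.map_cons, π₀₁_0, List.map_map]
      congr 1
      conv_rhs => rw [← List.map_id v']
      exact List.map_congr_left fun b _ => by cases b <;> rfl
    have e4 : ((0 : Fin 3) :: v'.map fun b => if b then (2 : Fin 3) else 1).map π₁₂ = e₀ N := by
      rw [List.map_cons, π₁₂_0, List.map_map, e₀]
      congr 1
      rw [List.eq_replicate_iff]
      refine ⟨by rw [List.length_map, hlen], fun b hb => ?_⟩
      obtain ⟨c, -, rfl⟩ := List.mem_map.mp hb
      cases c <;> rfl
    rw [e3, e4] at h2
    rw [← h1, h2]

omit [CommRing k] in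
/-- **All mixed words of length `N ≥ 3` have the same coefficient** `c_{X Y^{N-1}}`.
[folklore] -/
theorem apply_eq_apply_e₀_of_cocycle (hN : 3 ≤ N)
    (hrel : ∀ u : List (Fin 3), u.length ≤ N → (0 : Fin 3) ∈ u → (2 : Fin 3) ∈ u →
      Ψ (u.map π₀₁) = Ψ (u.map π₁₂)) :
    ∀ (n : ℕ) (w : List Bool), w.length = N → w.count false = n + 1 → 1 ≤ w.count true →
      Ψ w = Ψ (e₀ N) := by
  intro n
  induction n with
  | zero => exact fun w hw hX _ => apply_eq_apply_e₀_of_count_eq_one hN hrel hw hX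
  | succ n ih =>
    intro w hw hX hY
    rw [apply_eq_apply_flipFirst hrel hw.le (by omega) hY]
    obtain ⟨h1, h2⟩ := count_flipFirst w (n + 1) hX
    exact ih (flipFirst w) (by rw [length_flipFirst, hw]) h1 (by omega)

/-- `c_{X^N} = 0`. [folklore] -/
theorem apply_replicate_false_of_cocycle (hN : 1 ≤ N)
    (hrel : ∀ u : List (Fin 3), u.length ≤ N → (0 : Fin 3) ∈ u → (2 : Fin 3) ∉ u →
      Ψ (u.map π₀₁) = 0) :
    Ψ (List.replicate N false) = 0 := by
  have h := hrel (List.replicate N (0 : Fin 3)) (by simp)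
    (List.mem_replicate.mpr ⟨by omega, rfl⟩) (fun hm => by
      have := (List.mem_replicate.mp hm).2; exact absurd this (by decide))
  rwa [List.map_replicate, π₀₁_0] at h

/-- `c_{Y^N} = 0`. [folklore] -/
theorem apply_replicate_true_of_cocycle (hN : 1 ≤ N)
    (hrel : ∀ u : List (Fin 3), u.length ≤ N → (0 : Fin 3) ∉ u → (2 : Fin 3) ∈ u →
      Ψ (u.map π₁₂) = 0) :
    Ψ (List.replicate N true) = 0 := by
  have h := hrel (List.replicate N (2 : Fin 3)) (by simp)
    (fun hm => by have := (List.mem_replicate.mp hm).2; exact absurd this (by decide))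
    (List.mem_replicate.mpr ⟨by omega, rfl⟩)
  rwa [List.map_replicate, π₁₂_2] at h

end Mixed

/-! ## 5. Primitivity kills the remaining constant -/

section Primitive

variable {k : Type u} [CommRing k] [Algebra ℚ k] {N : ℕ} {Ψ : NCSeries Bool k}

/-- The members of `X ш Y^{n}`: words with one `X` and `n` `Y`'s. [folklore] -/
theorem count_of_mem_shuffleWord_singleton_replicate {n : ℕ} {w : List Bool}
    (hw : w ∈ MZV.shuffleWord [false] (List.replicate n true)) :
    w.count false = 1 ∧ w.count true = n := by
  have h := count_shuffleWord_replicate w 1 n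
  rw [List.replicate_one] at h
  by_contra hne
  rw [if_neg hne] at h
  exact (List.count_pos_iff.mpr hw).ne' h

/-- **Vanishing in degree `N ≥ 3`.** If `Ψ` satisfies the cocycle identity in
`k⟨x₀,x₁,x₂⟩/(deg > N)`, `N ≥ 3`, and its degree-`N` part is primitive, then `Ψ` has no terms
of degree `N`: all mixed words have the common coefficient `c`, pairing the primitive degree-`N`
part with `X ш Y^{N-1}` gives `N c = 0`, and `c_{X^N} = c_{Y^N} = 0`. (The vanishing of `H²` of the
normalised cochain complex of the free-algebra functor in degree `N ≥ 3`; elementary.) [folklore] -/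
theorem apply_eq_zero_of_cocycle_of_isPrimitive (hN : 3 ≤ N)
    (hC : evalTrunc N (bsub (xg (k := k) N 0 + xg N 1) (xg N 2)) Ψ +
        evalTrunc N (bsub (xg (k := k) N 0) (xg N 1)) Ψ =
      evalTrunc N (bsub (xg (k := k) N 0) (xg N 1 + xg N 2)) Ψ +
        evalTrunc N (bsub (xg (k := k) N 1) (xg N 2)) Ψ)
    (hprim : IsPrimitive (degPart N Ψ)) {w : List Bool} (hw : w.length = N) : Ψ w = 0 := by
  have hrel_a : ∀ u : List (Fin 3), u.length ≤ N → (0 : Fin 3) ∈ u → (2 : Fin 3) ∈ u →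
      Ψ (u.map π₀₁) = Ψ (u.map π₁₂) := fun u hu => (coeff_relations_of_cocycle hC hu).1
  have hrel_b : ∀ u : List (Fin 3), u.length ≤ N → (0 : Fin 3) ∈ u → (2 : Fin 3) ∉ u →
      Ψ (u.map π₀₁) = 0 := fun u hu => (coeff_relations_of_cocycle hC hu).2.1
  have hrel_c : ∀ u : List (Fin 3), u.length ≤ N → (0 : Fin 3) ∉ u → (2 : Fin 3) ∈ u →
      Ψ (u.map π₁₂) = 0 := fun u hu => (coeff_relations_of_cocycle hC hu).2.2
  -- the common coefficient of the mixed words vanishes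
  set c := Ψ (e₀ N)
  have hmixed : ∀ v : List Bool, v.length = N → 1 ≤ v.count false → 1 ≤ v.count true → Ψ v = c :=
    fun v hv hX hY => apply_eq_apply_e₀_of_cocycle hN hrel_a (v.count false - 1) v hv (by omega) hY
  have hc : c = 0 := by
    have hsum := hprim.2 [false] (List.replicate (N - 1) true) (by simp)
      (List.ne_nil_of_length_pos (by simp; omega))
    have hconst : (MZV.shuffleWord [false] (List.replicate (N - 1) true)).map (degPart N Ψ) =
        (MZV.shuffleWord [false] (List.replicate (N - 1) true)).map (fun _ => c) := by
      refine List.map_congr_left fun v hv => ?_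
      obtain ⟨h1, h2⟩ := count_of_mem_shuffleWord_singleton_replicate hv
      have hlen : v.length = N := by
        rw [MZV.length_of_mem_shuffleWord _ _ hv, List.length_singleton, List.length_replicate]; omega
      rw [degPart_apply, if_pos hlen]
      exact hmixed v hlen (by omega) (by omega)
    rw [hconst, List.map_const', List.sum_replicate, MZV.length_shuffleWord, List.length_singleton,
      List.length_replicate, show 1 + (N - 1) = N by omega, Nat.choose_one_right] at hsum
    -- `N • c = 0` in a `ℚ`-algebra
    have h' : ((N : ℕ) : ℚ) • c = 0 := by rw [Nat.cast_smul_eq_nsmul]; exact hsum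
    have hne : ((N : ℕ) : ℚ) ≠ 0 := Nat.cast_ne_zero.mpr (by omega)
    calc c = ((N : ℕ) : ℚ)⁻¹ • (((N : ℕ) : ℚ) • c) := by rw [smul_smul, inv_mul_cancel₀ hne, one_smul]
      _ = 0 := by rw [h', smul_zero]
  -- conclusion by cases on the letter counts
  by_cases hX : 1 ≤ w.count false
  · by_cases hY : 1 ≤ w.count true
    · rw [hmixed w hw hX hY, hc]
    · have hw' : w = List.replicate N false := by
        rw [eq_replicate_false_iff]
        have := List.count_not_add_count w true
        simp only [Bool.not_true] at this
        exact ⟨by omega, by omega⟩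
      rw [hw']
      exact apply_replicate_false_of_cocycle (by omega) hrel_b
  · have hw' : w = List.replicate N true := by
      rw [eq_replicate_true_iff]
      have := List.count_not_add_count w true
      simp only [Bool.not_true] at this
      exact ⟨by omega, by omega⟩
    rw [hw']
    exact apply_replicate_true_of_cocycle (by omega) hrel_c

end Primitive

end NCSeries

end Literature.NumberTheory.Transcendental
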